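import Summits.BirchSwinnertonDyer.BirchSwinnertonDyer.Theorems.ClassRecordThreeEulerHalvesAtThreeCartanCoverPrintClausesDescent
import Literature.NumberTheory.Automorphic.FuchsianEichlerShimuraWeightTwo
import Literature.NumberTheory.Automorphic.ShimuraParametrizationSplitCaseConverseProofs
import Literature.NumberTheory.Automorphic.ShimuraCurveDegreeFormulaProofs
import HarnessLib

/-!
# Crux NUM `CartanOnePlaceDegreeLawAtThree` (item 24801), line `lattice` — the print clauses XI: **ES-SURJECTIVITY DESCENDS ALONG ANY NORMAL SUBGROUP OF FINITE INDEX**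
# (averaging over the finite quotient `Γ ∕ Γ'`; the general form of `…PrintClausesDescent`)

Seat `bsd-stepL-tam3-p1` g29 (LEAD of crux 24801; `--supports stmt-BirchSwinnertonDyer-24801 --as helper`). Brick G1 of the LEAD's generalisation of the in-tree
surjectivity half of (ESᶜ) `eichlerShimura_weightTwo_rePeriod` from the cover groups `ι(O₀'¹)` to EVERY order of EVERY indefinite division quaternion algebra: for
subgroups `Γ' ≤ Γ ≤ SL₂(ℝ)` (inside `GL₂(ℝ)`, `Γ.HasDetOne`) with `Γ'` NORMAL and of FINITE INDEX in `Γ`, if every additive `u₁ : Γ' → ℝ` is the real period cochain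
`γ ↦ Re ∫_{z₀}^{γ z₀} F₁` of a weight-two cusp form `F₁` on `Γ'`, then every additive `u : Γ → ℝ` is the real period cochain of a weight-two cusp form on `Γ`:
**`esSurj_of_normal_finiteIndex`**. PROOF (Shimura §8.1 (8.1.2)–(8.1.3), res ∕ transfer): realise `u|Γ'` by `F₁`; the average `Σ_{c ∈ Γ∕Γ'} F₁ ∣[2] c̃⁻¹` over coset
representatives is `Γ`-invariant (left multiplication permutes the cosets, `Γ'` acts trivially), so a cusp form on `Γ` (the cusps of `Γ` are cusps of `Γ'`); its real
period at `γ ∈ Γ'` is `[Γ:Γ'] · u γ` (`Re ∫_{z₀}^{γ z₀} F₁ ∣[2] g⁻¹ = Re ∫^{(g⁻¹ γ g)}F₁ = u (g⁻¹ γ g) = u γ`, `u` being a class function), and since `γ^{[Γ:Γ']} ∈ Γ'` and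
periods are additive the normalised average has real periods `u` on all of `Γ`. `…PrintClausesDescent` is the instance `Γ̄(q) ⊴ ι(O₀'¹)`.
Theorems only; nothing about NUM or any curve is proved; BSD is proved for no curve.
[cite: ShimuraIATAF1971, Thm. 8.4 p. 234 and §8.1 (8.1.2)–(8.1.3)]
-/

set_option linter.dupNamespace false
set_option autoImplicit false

noncomputable section

open scoped MatrixGroups ModularForm Pointwise
open Function Set

namespace Summit.BirchSwinnertonDyer.BirchSwinnertonDyer.Theorems.CartanCover.PrintClauses

open Literature.NumberTheory.Automorphic

section General

variable {Γ' Γ : Subgroup (GL (Fin 2) ℝ)}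

/-! ## §1 Normal subgroups: conjugation, cusps -/

/-- For `Γ'` normal in `Γ` (as `Γ'.subgroupOf Γ`) and `g ∈ Γ`: `g Γ' g⁻¹ = Γ'`. [folklore] -/
theorem conjAct_smul_eq_of_normal_subgroupOf (hle : Γ' ≤ Γ) (hN : (Γ'.subgroupOf Γ).Normal) {g : GL (Fin 2) ℝ} (hg : g ∈ Γ) :
    ConjAct.toConjAct g • Γ' = Γ' := by
  have key : ∀ {g : GL (Fin 2) ℝ}, g ∈ Γ → ∀ {h : GL (Fin 2) ℝ}, h ∈ Γ' → g * h * g⁻¹ ∈ Γ' := by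
    intro g hg h hh
    have h1 := hN.conj_mem ⟨h, hle hh⟩ (by rw [Subgroup.mem_subgroupOf]; exact hh) ⟨g, hg⟩
    rw [Subgroup.mem_subgroupOf] at h1
    exact h1
  ext h
  rw [Subgroup.mem_pointwise_smul_iff_inv_smul_mem, ← ConjAct.toConjAct_inv, ConjAct.toConjAct_smul, inv_inv]
  constructor
  · intro hh
    have h2 := key hg hh
    simpa [mul_assoc] using h2
  · intro hh
    have h2 := key (Γ.inv_mem hg) hh
    simpa [mul_assoc] using h2

/-- `g⁻¹ h g ∈ Γ'` for `h ∈ Γ'`, `g ∈ Γ`, `Γ'` normal in `Γ`. [folklore] -/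
theorem conj_mem_of_normal_subgroupOf (hle : Γ' ≤ Γ) (hN : (Γ'.subgroupOf Γ).Normal) {g : GL (Fin 2) ℝ} (hg : g ∈ Γ) {h : GL (Fin 2) ℝ} (hh : h ∈ Γ') :
    g⁻¹ * h * g ∈ Γ' := by
  have h1 := hN.conj_mem ⟨h, hle hh⟩ (by rw [Subgroup.mem_subgroupOf]; exact hh) ⟨g, hg⟩⁻¹
  rw [Subgroup.mem_subgroupOf] at h1
  simpa [mul_assoc] using h1

/-- A cusp of `Γ` is a cusp of any subgroup of finite index (Mathlib `IsCusp.of_isFiniteRelIndex`). [folklore] -/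
theorem isCusp_of_isCusp_of_finiteIndex (hfi : (Γ'.subgroupOf Γ).FiniteIndex) {c : OnePoint ℝ} (hc : IsCusp c Γ) : IsCusp c Γ' := by
  haveI : Γ'.IsFiniteRelIndex Γ := ⟨hfi.index_ne_zero⟩
  exact hc.of_isFiniteRelIndex

/-! ## §2 Translates `F₁ ∣[2] g⁻¹` of a form on `Γ'` by `g ∈ Γ` -/

/-- **`F₁ ∣[2] g⁻¹` is again a weight-two cusp form on `Γ'`** for `g ∈ Γ` normalising `Γ'` (Mathlib `CuspForm.translate`, transported along `g Γ' g⁻¹ = Γ'`); stated as an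
existence so that no definition is introduced. [cite: ShimuraIATAF1971, §8.1 (8.1.3)] -/
theorem exists_cuspForm_coe_eq_slash_inv (hle : Γ' ≤ Γ) (hN : (Γ'.subgroupOf Γ).Normal) (F₁ : CuspForm Γ' 2) {g : GL (Fin 2) ℝ} (hg : g ∈ Γ) :
    ∃ F : CuspForm Γ' 2, ⇑F = ⇑F₁ ∣[(2 : ℤ)] g⁻¹ :=
  ⟨(CuspForm.translate F₁ g⁻¹).copy (⇑F₁ ∣[(2 : ℤ)] g⁻¹) rfl
      (by rw [inv_inv]; exact (conjAct_smul_eq_of_normal_subgroupOf hle hN hg).symm), rfl⟩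

/-- Base-point independence of the periods of a form on `Γ'`: `∫_w^{δ w} F = ∫_{z₀}^{δ z₀} F` for `δ ∈ Γ'` of determinant one. [cite: ShimuraIATAF1971, §8.2 (8.2.19)–(8.2.20)] -/
theorem segmentIntegral_smul_self_eq (F : CuspForm Γ' 2) {δ : GL (Fin 2) ℝ} (hδ : δ ∈ Γ') (hdet : 0 < δ.det.val) (z₀ w : UpperHalfPlane) :
    segmentIntegral F w (δ • w) = segmentIntegral F z₀ (δ • z₀) := by
  have hinv : segmentIntegral F (δ • z₀) (δ • w) = segmentIntegral F z₀ w := by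
    rw [← segmentIntegral_slash_eq F hdet z₀ w, SlashInvariantForm.slash_action_eqn F δ hδ]
  have e1 := segmentIntegral_sub_segmentIntegral F z₀ w (δ • w)
  have e2 := segmentIntegral_sub_segmentIntegral F z₀ (δ • z₀) (δ • w)
  linear_combination (-1 : ℂ) * e1 + e2 + hinv

/-- **Period of a translate: `Re ∫_{z₀}^{γ z₀} F₁ ∣[2] g⁻¹ = Re ∫_{z₀}^{(g⁻¹ γ g) z₀} F₁`** for `γ ∈ Γ'`, `g ∈ Γ` (`Γ.HasDetOne`, `Γ'` normal in `Γ`).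
[cite: ShimuraIATAF1971, §8.3 (8.3.2)] -/
theorem rePeriod_of_coe_eq_slash_inv [Γ.HasDetOne] (hle : Γ' ≤ Γ) (hN : (Γ'.subgroupOf Γ).Normal) (F₁ F : CuspForm Γ' 2) {g : GL (Fin 2) ℝ} (hg : g ∈ Γ)
    (hF : ⇑F = ⇑F₁ ∣[(2 : ℤ)] g⁻¹) (z₀ : UpperHalfPlane) (γ : Γ') :
    CuspForm.rePeriod F z₀ γ = CuspForm.rePeriod F₁ z₀ ⟨g⁻¹ * γ * g, conj_mem_of_normal_subgroupOf hle hN hg γ.2⟩ := by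
  have hdetg : 0 < (g⁻¹).det.val := by rw [Subgroup.HasDetOne.det_eq (Γ.inv_mem hg), Units.val_one]; exact one_pos
  rw [CuspForm.rePeriod_apply, CuspForm.rePeriod_apply, hF, segmentIntegral_slash_eq F₁ hdetg z₀ _]
  congr 1
  have h1 : g⁻¹ • ((γ : GL (Fin 2) ℝ) • z₀) = (g⁻¹ * γ * g) • (g⁻¹ • z₀) := by simp only [mul_smul, smul_inv_smul]
  rw [h1]
  have hdetδ : 0 < (g⁻¹ * γ * g).det.val := by
    rw [Subgroup.HasDetOne.det_eq (hle (conj_mem_of_normal_subgroupOf hle hN hg γ.2)), Units.val_one]; exact one_pos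
  exact segmentIntegral_smul_self_eq F₁ (conj_mem_of_normal_subgroupOf hle hN hg γ.2) hdetδ z₀ _

/-! ## §3 Sums of forms (the class-function lemmas `addCochain_conj` ∕ `addCochain_pow` are those of `…PrintClausesDescent`) -/

/-- Real periods of a finite sum of forms. -/
theorem rePeriod_finset_sum {Γ : Subgroup (GL (Fin 2) ℝ)} {ι : Type*} (s : Finset ι) (F : ι → CuspForm Γ 2) (z₀ : UpperHalfPlane) (γ : Γ) :
    CuspForm.rePeriod (∑ i ∈ s, F i) z₀ γ = ∑ i ∈ s, CuspForm.rePeriod (F i) z₀ γ := by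
  classical
  induction s using Finset.induction_on with
  | empty =>
    rw [Finset.sum_empty, Finset.sum_empty]
    have h := CuspForm.rePeriod_smul (0 : ℝ) (0 : CuspForm Γ 2) z₀ γ
    rw [zero_smul, zero_mul] at h
    exact h
  | insert i s hi ih => rw [Finset.sum_insert hi, Finset.sum_insert hi, CuspForm.rePeriod_add, ih]

/-- Underlying function of a finite sum of cusp forms. -/
theorem coe_finset_sum {Γ : Subgroup (GL (Fin 2) ℝ)} {k : ℤ} {ι : Type*} (s : Finset ι) (F : ι → CuspForm Γ k) :
    ⇑(∑ i ∈ s, F i) = ∑ i ∈ s, ⇑(F i) := by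
  classical
  induction s using Finset.induction_on with
  | empty => rw [Finset.sum_empty, Finset.sum_empty]; rfl
  | insert i s hi ih => rw [Finset.sum_insert hi, Finset.sum_insert hi, CuspForm.coe_add, ih]

/-- The slash action distributes over finite sums of functions. -/
theorem finset_sum_slash {k : ℤ} {ι : Type*} (s : Finset ι) (f : ι → UpperHalfPlane → ℂ) (g : GL (Fin 2) ℝ) :
    (∑ i ∈ s, f i) ∣[k] g = ∑ i ∈ s, (f i ∣[k] g) := by
  classical
  induction s using Finset.induction_on with
  | empty => rw [Finset.sum_empty, Finset.sum_empty]; exact SlashAction.zero_slash k g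
  | insert i s hi ih => rw [Finset.sum_insert hi, Finset.sum_insert hi, SlashAction.add_slash, ih]

/-! ## §4 The descent -/

/-- **ES-SURJECTIVITY DESCENDS ALONG A NORMAL SUBGROUP OF FINITE INDEX.** `Γ' ≤ Γ ≤ SL₂(ℝ)` with `Γ'` normal of finite index in `Γ`: if every additive `u₁ : Γ' → ℝ` is
the real period cochain (base point `z₀`) of a weight-two cusp form on `Γ'`, then every additive `u : Γ → ℝ` is the real period cochain of a weight-two cusp form on `Γ`
— namely `[Γ:Γ']⁻¹ Σ_{c ∈ Γ∕Γ'} F₁ ∣[2] c̃⁻¹` for `F₁` realising `u|Γ'`. [cite: ShimuraIATAF1971, Thm. 8.4 p. 234 and §8.1 (8.1.2)–(8.1.3)] -/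
theorem esSurj_of_normal_finiteIndex [Γ.HasDetOne] (hle : Γ' ≤ Γ) (hN : (Γ'.subgroupOf Γ).Normal) (hfi : (Γ'.subgroupOf Γ).FiniteIndex)
    (z₀ : UpperHalfPlane)
    (h₁ : ∀ u₁ : Γ' → ℝ, (∀ γ δ : Γ', u₁ (γ * δ) = u₁ γ + u₁ δ) → ∃ F₁ : CuspForm Γ' 2, ∀ γ : Γ', CuspForm.rePeriod F₁ z₀ γ = u₁ γ)
    (u : Γ → ℝ) (hu : ∀ γ δ : Γ, u (γ * δ) = u γ + u δ) :
    ∃ F : CuspForm Γ 2, ∀ γ : Γ, CuspForm.rePeriod F z₀ γ = u γ := by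
  classical
  -- the finite quotient
  set Q := Γ ⧸ Γ'.subgroupOf Γ with hQdef
  haveI : Finite Q := Subgroup.finite_quotient_of_finiteIndex
  letI : Fintype Q := Fintype.ofFinite Q
  -- realise `u|Γ'`
  set u₁ : Γ' → ℝ := fun γ => u ⟨γ, hle γ.2⟩ with hu₁
  obtain ⟨F₁, hF₁⟩ := h₁ u₁ fun γ δ => hu ⟨γ, hle γ.2⟩ ⟨δ, hle δ.2⟩
  -- translates by representatives
  have hT : ∀ c : Q, ∃ F : CuspForm Γ' 2, ⇑F = ⇑F₁ ∣[(2 : ℤ)] ((c.out : Γ) : GL (Fin 2) ℝ)⁻¹ :=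
    fun c => exists_cuspForm_coe_eq_slash_inv hle hN F₁ (c.out : Γ).2
  choose T hT using hT
  set G : CuspForm Γ' 2 := ∑ c : Q, T c with hGdef
  have hGcoe : ⇑G = ∑ c : Q, (⇑F₁ ∣[(2 : ℤ)] ((c.out : Γ) : GL (Fin 2) ℝ)⁻¹) := by
    rw [hGdef, coe_finset_sum]
    exact Finset.sum_congr rfl fun c _ => hT c
  -- `Γ`-invariance of `G`
  have hGinv : ∀ g ∈ Γ, (⇑G) ∣[(2 : ℤ)] g = ⇑G := by
    intro g hg
    rw [hGcoe, finset_sum_slash]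
    -- summand `c`: `(F₁ ∣ c̃⁻¹) ∣ g = F₁ ∣ (c̃⁻¹ g) = F₁ ∣ c̃'⁻¹` with `c' = g⁻¹ • c`
    have hterm : ∀ c : Q, (⇑F₁ ∣[(2 : ℤ)] ((c.out : Γ) : GL (Fin 2) ℝ)⁻¹) ∣[(2 : ℤ)] g =
        ⇑F₁ ∣[(2 : ℤ)] ((((⟨g, hg⟩ : Γ)⁻¹ • c).out : Γ) : GL (Fin 2) ℝ)⁻¹ := by
      intro c
      rw [← SlashAction.slash_mul]
      -- `k := (g⁻¹ c̃)⁻¹ (g⁻¹ • c).out ∈ Γ'`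
      set c' : Q := (⟨g, hg⟩ : Γ)⁻¹ • c with hc'
      have h1 : (QuotientGroup.mk ((⟨g, hg⟩ : Γ)⁻¹ * c.out) : Q) = c' := by
        rw [hc']
        conv_rhs => rw [← QuotientGroup.out_eq' c]
        rfl
      have h2 : ((⟨g, hg⟩ : Γ)⁻¹ * c.out)⁻¹ * c'.out ∈ Γ'.subgroupOf Γ := by
        rw [← QuotientGroup.eq, h1, QuotientGroup.out_eq']
      rw [Subgroup.mem_subgroupOf] at h2
      -- so `c̃⁻¹ g = k c̃'⁻¹` with `k ∈ Γ'`
      have h3 : ((c.out : Γ) : GL (Fin 2) ℝ)⁻¹ * g =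
          ((((⟨g, hg⟩ : Γ)⁻¹ * c.out)⁻¹ * c'.out : Γ) : GL (Fin 2) ℝ) * ((c'.out : Γ) : GL (Fin 2) ℝ)⁻¹ := by
        simp only [Subgroup.coe_mul, Subgroup.coe_inv, mul_inv_rev, inv_inv, mul_assoc, mul_inv_cancel, mul_one]
      rw [h3, SlashAction.slash_mul, SlashInvariantForm.slash_action_eqn F₁ _ h2]
    simp_rw [hterm]
    exact Fintype.sum_equiv (MulAction.toPerm ((⟨g, hg⟩ : Γ)⁻¹)) _ _ fun c => rfl
  -- `G` as a cusp form on `Γ`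
  let Gup : CuspForm Γ 2 :=
    { toFun := ⇑G
      slash_action_eq' := fun g hg => hGinv g hg
      holo' := G.holo'
      zero_at_cusps' := fun hc => G.zero_at_cusps' (isCusp_of_isCusp_of_finiteIndex hfi hc) }
  have hGup : ∀ γ : Γ', CuspForm.rePeriod Gup z₀ ⟨γ, hle γ.2⟩ = CuspForm.rePeriod G z₀ γ := fun γ => rfl
  -- periods of `G` on `Γ'`: `N · u`
  set N : ℕ := Fintype.card Q with hNdef
  have hNpos : 0 < N := Fintype.card_pos
  have havg : ∀ γ : Γ', CuspForm.rePeriod G z₀ γ = N * u ⟨γ, hle γ.2⟩ := by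
    intro γ
    rw [hGdef, rePeriod_finset_sum]
    have hterm : ∀ c : Q, CuspForm.rePeriod (T c) z₀ γ = u ⟨γ, hle γ.2⟩ := by
      intro c
      rw [rePeriod_of_coe_eq_slash_inv hle hN F₁ (T c) (c.out : Γ).2 (hT c) z₀ γ, hF₁, hu₁]
      have h := addCochain_conj hu (c.out : Γ) ⟨γ, hle γ.2⟩
      convert h using 2
      exact Subtype.ext (by simp [mul_assoc])
    simp_rw [hterm]
    rw [Finset.sum_const, Finset.card_univ, nsmul_eq_mul]
  -- the normalised lift
  refine ⟨(N : ℝ)⁻¹ • Gup, fun γ => ?_⟩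
  rw [CuspForm.rePeriod_smul]
  have hidx : (Γ'.subgroupOf Γ).index = N := by rw [hNdef, Subgroup.index_eq_card, Nat.card_eq_fintype_card]
  have hγN : ((γ ^ N : Γ) : GL (Fin 2) ℝ) ∈ Γ' := by
    have h := (Γ'.subgroupOf Γ).pow_index_mem γ
    rw [Subgroup.mem_subgroupOf, hidx] at h
    exact h
  have hadd : ∀ a b : Γ, CuspForm.rePeriod Gup z₀ (a * b) = CuspForm.rePeriod Gup z₀ a + CuspForm.rePeriod Gup z₀ b := CuspForm.rePeriod_mul _ z₀
  have hpow := addCochain_pow hadd γ N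
  have hper : CuspForm.rePeriod Gup z₀ (γ ^ N) = N * (N * u γ) := by
    have h1 : CuspForm.rePeriod Gup z₀ (γ ^ N) = CuspForm.rePeriod G z₀ ⟨((γ ^ N : Γ) : GL (Fin 2) ℝ), hγN⟩ := rfl
    rw [h1, havg]
    congr 1
    have h2 := addCochain_pow hu γ N
    convert h2 using 2
  have hNne : (N : ℝ) ≠ 0 := by exact_mod_cast hNpos.ne'
  have h3 : (N : ℝ) * CuspForm.rePeriod Gup z₀ γ = N * (N * u γ) := by rw [← hpow, hper]
  have h4 : CuspForm.rePeriod Gup z₀ γ = N * u γ := mul_left_cancel₀ hNne h3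
  rw [h4, ← mul_assoc, inv_mul_cancel₀ hNne, one_mul]

end General

end Summit.BirchSwinnertonDyer.BirchSwinnertonDyer.Theorems.CartanCover.PrintClauses

end
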